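import Summits.CriticalPhenomena.PercolationContinuityZ3.Theorems.PercNearOneGluingNoHeavyLowerTailAntitheticCycleReflect
import Summits.CriticalPhenomena.PercolationContinuityZ3.Theorems.PercNearOneGluingNoHeavyLowerTailAntitheticPeelTools
import HarnessLib

/-!
# `NoHeavyLowerTail` (stmt-CriticalPhenomena-4575) — antithetic cluster pairs: CONTRACTING a tied vertex of a cycle (THEOREM C, file C3a; prim-hp-2
# gen 39/40, HOME/THEOREM-C-cycles.md "LEAN BLUEPRINT")

Support file (`--supports stmt-CriticalPhenomena-4575`, hull-port prover `prim-hp-2`, gen 40).  No named facts, no sorries; standard axioms.  The `def`s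
`Antithetic.Cyc.{skip, expand, swap}` are proof-internal bookkeeping.

SETTING: a cycle `v 0 = s, …, v n, v (n+1) = v 0` with `n + 1 ≥ 4` vertices and a position `1 ≤ a ≤ n`.  The CONTRACTED cycle `skip v a` (`n` vertices)
forgets `v a`: its pair `e' = v (a−1) v (a+1)` replaces the two pairs `edge v (a−1)`, `edge v a`.  `expand` maps an edge set of the contracted cycle to
the corresponding edge set of the big one (`e' ↦` both pairs; increasing), `swap` exchanges the coordinates `e'` and `edge v (a−1)` of a colouring, so
that a colouring `ω'` read on the small cycle becomes the colouring `swap ω'` of the big cycle in which `edge v (a−1)` carries the colour of `e'`; when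
the coordinates `e'` and `edge v a` of `ω'` agree ("tied"), `swap ω'` has no colour change at `v a`.
* `Cyc.letter` — the colour of `edge v i` in `swap ω'` is the colour of the corresponding pair of the small cycle;
* `Cyc.pre_swap`, `Cyc.suf_swap` — the red prefix / suffix runs correspond (shifted by one past the doubled letter);
* `Cyc.cluster_swap` — the red edge cluster of `s` in `swap ω'` is `expand` of the red edge cluster of `s` in `ω'`.
The constraint / functional correspondence and the identity `2 · Σ_{tied} Δ_E = T_{E'}(R,∅; F ∘ expand, G ∘ expand)` follow in file C3b
(…CycleContractSum); with the staircase lemma (…CycleStairSum) this is the induction step of THEOREM C (…Cycle).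
[cite: VandenbergHaggstromKahn2005, §1 p. 3 (open cluster `C_s`)]
-/

noncomputable section

namespace Summit.CriticalPhenomena.PercolationContinuityZ3.Theorems

open Literature.Probability.Percolation
open scoped Classical symmDiff

namespace Antithetic

namespace Cyc

variable {V : Type*}

/-- The contracted parametrisation: skip the vertex `v a`. [this work] -/
def skip (v : ℕ → V) (a : ℕ) : ℕ → V := fun i => if i < a then v i else v (i + 1)

/-- Expand an edge set of the contracted cycle: the merged pair `e'` stands for the two pairs `edge v (a−1)`, `edge v a`. [this work] -/
def expand (v : ℕ → V) (a : ℕ) (C : Set (Sym2 V)) : Set (Sym2 V) :=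
  {e | (e ∈ C ∧ e ≠ edge (skip v a) (a - 1)) ∨ (edge (skip v a) (a - 1) ∈ C ∧ (e = edge v (a - 1) ∨ e = edge v a))}

/-- Exchange the coordinates `e' = edge (skip v a) (a−1)` and `edge v (a−1)` of a colouring. [this work] -/
def swap (v : ℕ → V) (a : ℕ) (ω : Set (Sym2 V)) : Set (Sym2 V) :=
  {e | (e = edge (skip v a) (a - 1) ∧ edge v (a - 1) ∈ ω) ∨ (e = edge v (a - 1) ∧ edge (skip v a) (a - 1) ∈ ω) ∨
    (e ≠ edge (skip v a) (a - 1) ∧ e ≠ edge v (a - 1) ∧ e ∈ ω)}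

variable {n : ℕ} {v : ℕ → V} (hn : 3 ≤ n) (hinj : ∀ i j, i < n + 1 → j < n + 1 → v i = v j → i = j) (hper : v (n + 1) = v 0)
  {a : ℕ} (ha1 : 1 ≤ a) (han : a ≤ n)

section Basic

/-- Values of `skip` below `a`. -/
theorem skip_lt {i : ℕ} (hi : i < a) : skip v a i = v i := if_pos hi

/-- Values of `skip` from `a` on. -/
theorem skip_ge {i : ℕ} (hi : a ≤ i) : skip v a i = v (i + 1) := if_neg (by omega)

include hper ha1 han in
/-- The contracted parametrisation is periodic. -/
theorem skip_per : skip v a n = skip v a 0 := by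
  rw [skip_ge han, skip_lt (by omega), hper]

include hinj in
/-- The contracted parametrisation is injective on `[0, n)`. -/
theorem skip_inj : ∀ i j, i < n → j < n → skip v a i = skip v a j → i = j := by
  intro i j hi hj h
  by_cases hia : i < a <;> by_cases hja : j < a
  · rw [skip_lt hia, skip_lt hja] at h; exact hinj i j (by omega) (by omega) h
  · rw [skip_lt hia, skip_ge (by omega)] at h; have := hinj i (j + 1) (by omega) (by omega) h; omega
  · rw [skip_ge (by omega), skip_lt hja] at h; have := hinj (i + 1) j (by omega) (by omega) h; omega
  · rw [skip_ge (by omega), skip_ge (by omega)] at h; have := hinj (i + 1) (j + 1) (by omega) (by omega) h; omega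

/-- Pairs of the contracted cycle below the merged one. -/
theorem edge_skip_lt {i : ℕ} (hi : i + 1 < a) : edge (skip v a) i = edge v i := by
  unfold edge; rw [skip_lt (by omega), skip_lt hi]

include ha1 in
/-- The merged pair. -/
theorem edge_skip_mid : edge (skip v a) (a - 1) = s(v (a - 1), v (a + 1)) := by
  unfold edge; rw [skip_lt (by omega), show a - 1 + 1 = a by omega, skip_ge le_rfl]

/-- Pairs of the contracted cycle above the merged one. -/
theorem edge_skip_ge {i : ℕ} (hi : a ≤ i) : edge (skip v a) i = edge v (i + 1) := by
  unfold edge; rw [skip_ge hi, skip_ge (by omega)]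

include hn hinj hper ha1 han in
/-- The merged pair is not a pair of the big cycle. -/
theorem mid_ne_edge {i : ℕ} (hi : i < n + 1) : edge (skip v a) (a - 1) ≠ edge v i := by
  rw [edge_skip_mid ha1]
  unfold edge
  intro h
  rcases Sym2.eq_iff.1 h with ⟨h1, h2⟩ | ⟨h1, h2⟩
  · rcases idx_eq (n := n + 1) (by omega) hinj hper (by omega) hi.le h1 with h' | ⟨h', h''⟩ | ⟨h', h''⟩
    · rcases idx_eq (n := n + 1) (by omega) hinj hper (by omega) (by omega : i + 1 ≤ n + 1) h2 with h3 | ⟨h3, h4⟩ | ⟨h3, h4⟩ <;> omega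
    · omega
    · omega
  · rcases idx_eq (n := n + 1) (by omega) hinj hper (by omega) (by omega : i + 1 ≤ n + 1) h1 with h' | ⟨h', h''⟩ | ⟨h', h''⟩
    · rcases idx_eq (n := n + 1) (by omega) hinj hper (by omega) hi.le h2 with h3 | ⟨h3, h4⟩ | ⟨h3, h4⟩ <;> omega
    · rcases idx_eq (n := n + 1) (by omega) hinj hper (by omega) hi.le h2 with h3 | ⟨h3, h4⟩ | ⟨h3, h4⟩ <;> omega
    · omega

end Basic

section Swap

variable (hne : edge (skip v a) (a - 1) ≠ edge v (a - 1))
include hne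

/-- The merged coordinate of a swapped colouring. -/
theorem mem_swap_mid (ω : Set (Sym2 V)) : edge (skip v a) (a - 1) ∈ swap v a ω ↔ edge v (a - 1) ∈ ω := by
  unfold swap; simp only [Set.mem_setOf_eq]
  constructor
  · rintro (⟨-, h⟩ | ⟨h, -⟩ | ⟨h, -, -⟩)
    · exact h
    · exact absurd h hne
    · exact absurd rfl h
  · exact fun h => Or.inl ⟨trivial, h⟩

/-- The coordinate `edge v (a−1)` of a swapped colouring. -/
theorem mem_swap_am1 (ω : Set (Sym2 V)) : edge v (a - 1) ∈ swap v a ω ↔ edge (skip v a) (a - 1) ∈ ω := by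
  unfold swap; simp only [Set.mem_setOf_eq]
  constructor
  · rintro (⟨h, -⟩ | ⟨-, h⟩ | ⟨-, h, -⟩)
    · exact absurd h.symm hne
    · exact h
    · exact absurd rfl h
  · exact fun h => Or.inr (Or.inl ⟨trivial, h⟩)

omit hne in
/-- The other coordinates of a swapped colouring. -/
theorem mem_swap_other (ω : Set (Sym2 V)) {e : Sym2 V} (h1 : e ≠ edge (skip v a) (a - 1)) (h2 : e ≠ edge v (a - 1)) :
    e ∈ swap v a ω ↔ e ∈ ω := by
  unfold swap; simp only [Set.mem_setOf_eq]; tauto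

/-- `swap` is an involution. -/
theorem swap_swap (ω : Set (Sym2 V)) : swap v a (swap v a ω) = ω := by
  ext e
  by_cases h1 : e = edge (skip v a) (a - 1)
  · subst h1; rw [mem_swap_mid hne, mem_swap_am1 hne]
  · by_cases h2 : e = edge v (a - 1)
    · subst h2; rw [mem_swap_am1 hne, mem_swap_mid hne]
    · rw [mem_swap_other (swap v a ω) h1 h2, mem_swap_other ω h1 h2]

/-- `swap` commutes with complement. -/
theorem swap_compl (ω : Set (Sym2 V)) : (swap v a ω)ᶜ = swap v a ωᶜ := by
  ext e
  rw [Set.mem_compl_iff]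
  by_cases h1 : e = edge (skip v a) (a - 1)
  · subst h1; rw [mem_swap_mid hne, mem_swap_mid hne, Set.mem_compl_iff]
  · by_cases h2 : e = edge v (a - 1)
    · subst h2; rw [mem_swap_am1 hne, mem_swap_am1 hne, Set.mem_compl_iff]
    · rw [mem_swap_other ω h1 h2, mem_swap_other ωᶜ h1 h2, Set.mem_compl_iff]

end Swap

section Word

include hn hinj hper ha1 han

/-- The merged pair differs from `edge v (a−1)`. -/
theorem mid_ne : edge (skip v a) (a - 1) ≠ edge v (a - 1) := mid_ne_edge hn hinj hper ha1 han (by omega)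

/-- **Letter correspondence**: with `σ i = i` (`i < a`) resp. `i − 1` (`i ≥ a`), the colour of `edge v i` in `swap ω'` is the colour of
`edge (skip v a) (σ i)` in `ω'` — for `i = a` provided the coordinates `e'` and `edge v a` of `ω'` agree. [this work] -/
theorem letter (ω' : Set (Sym2 V)) (hT : edge (skip v a) (a - 1) ∈ ω' ↔ edge v a ∈ ω') {i : ℕ} (hi : i < n + 1) :
    edge v i ∈ swap v a ω' ↔ edge (skip v a) (if i < a then i else i - 1) ∈ ω' := by
  have hne := mid_ne hn hinj hper ha1 han
  by_cases hia : i < a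
  · rw [if_pos hia]
    by_cases hi1 : i + 1 < a
    · rw [edge_skip_lt hi1, mem_swap_other ω' ((mid_ne_edge hn hinj hper ha1 han hi).symm) fun h => by
        have := edge_inj (n := n + 1) (by omega) hinj hper hi (by omega) h; omega]
    · have hieq : i = a - 1 := by omega
      subst hieq
      rw [mem_swap_am1 hne]
  · rw [if_neg hia]
    by_cases hieq : i = a
    · subst hieq
      rw [mem_swap_other ω' ((mid_ne_edge hn hinj hper ha1 han hi).symm) fun h => by
        have := edge_inj (n := n + 1) (by omega) hinj hper hi (by omega) h; omega]
      exact hT.symm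
    · rw [show edge (skip v a) (i - 1) = edge v i by rw [edge_skip_ge (by omega), show i - 1 + 1 = i by omega],
        mem_swap_other ω' ((mid_ne_edge hn hinj hper ha1 han hi).symm) fun h => by
          have := edge_inj (n := n + 1) (by omega) hinj hper hi (by omega) h; omega]

/-- **Prefix runs correspond**: `pre` of the big tied colouring is `pre` of the small one, shifted past the doubled letter. [this work] -/
theorem pre_swap (ω' : Set (Sym2 V)) (hT : edge (skip v a) (a - 1) ∈ ω' ↔ edge v a ∈ ω') :
    pre (n + 1) v (swap v a ω') = if pre n (skip v a) ω' < a then pre n (skip v a) ω' else pre n (skip v a) ω' + 1 := by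
  set p := pre n (skip v a) ω' with hp
  have hpn : p ≤ n := pre_le ω'
  split_ifs with hpa
  · apply le_antisymm
    · by_contra hlt
      push Not at hlt
      have hred := red_of_lt_pre (swap v a ω') hlt
      rw [letter hn hinj hper ha1 han ω' hT (by omega), if_pos hpa] at hred
      exact not_red_pre ω' (by omega) hred
    · refine le_pre (swap v a ω') (by omega) fun i hi => ?_
      rw [letter hn hinj hper ha1 han ω' hT (by omega), if_pos (by omega)]
      exact red_of_lt_pre ω' hi
  · apply le_antisymm
    · by_cases hpn' : p = n
      · rw [hpn']; exact pre_le _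
      · by_contra hlt
        push Not at hlt
        have hred := red_of_lt_pre (swap v a ω') hlt
        rw [letter hn hinj hper ha1 han ω' hT (by omega), if_neg (by omega), show p + 1 - 1 = p by omega] at hred
        exact not_red_pre ω' (by omega) hred
    · refine le_pre (swap v a ω') (by omega) fun i hi => ?_
      rw [letter hn hinj hper ha1 han ω' hT (by omega)]
      split_ifs with hia
      · exact red_of_lt_pre (n := n) (v := skip v a) ω' (by omega)
      · exact red_of_lt_pre (n := n) (v := skip v a) ω' (by omega)

/-- **Suffix runs correspond.** [this work] -/
theorem suf_swap (ω' : Set (Sym2 V)) (hT : edge (skip v a) (a - 1) ∈ ω' ↔ edge v a ∈ ω') :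
    suf (n + 1) v (swap v a ω') = if suf n (skip v a) ω' ≤ n - a then suf n (skip v a) ω' else suf n (skip v a) ω' + 1 := by
  set q := suf n (skip v a) ω' with hq
  have hqn : q ≤ n := suf_le ω'
  -- big top letter `b` is `edge v (n - b)`; it reads the small letter `σ (n - b)`
  have key : ∀ b, b < n + 1 → (edge v (n + 1 - 1 - b) ∈ swap v a ω' ↔
      edge (skip v a) (if n - b < a then n - b else n - b - 1) ∈ ω') := fun b hb => by
    rw [show n + 1 - 1 - b = n - b by omega]; exact letter hn hinj hper ha1 han ω' hT (by omega)
  split_ifs with hqa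
  · apply le_antisymm
    · by_contra hlt
      push Not at hlt
      have hred := red_of_lt_suf (swap v a ω') hlt
      rw [key q (by omega), if_neg (by omega), show n - q - 1 = n - 1 - q by omega] at hred
      exact not_red_suf ω' (by omega) hred
    · refine le_suf (swap v a ω') (by omega) fun j hj => ?_
      rw [key j (by omega), if_neg (by omega), show n - j - 1 = n - 1 - j by omega]
      exact red_of_lt_suf ω' hj
  · apply le_antisymm
    · by_cases hqn' : q = n
      · rw [hqn']; exact suf_le _
      · by_contra hlt
        push Not at hlt
        have hred := red_of_lt_suf (swap v a ω') hlt
        rw [key (q + 1) (by omega), if_pos (by omega), show n - (q + 1) = n - 1 - q by omega] at hred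
        exact not_red_suf ω' (by omega) hred
    · refine le_suf (swap v a ω') (by omega) fun j hj => ?_
      rw [key j (by omega)]
      split_ifs with hja
      · rw [show n - j = n - 1 - (j - 1) by omega]; exact red_of_lt_suf ω' (by omega)
      · rw [show n - j - 1 = n - 1 - j by omega]; exact red_of_lt_suf ω' (by omega)

/-- **Clusters correspond**: the red edge cluster of `s` in the big tied colouring is the expansion of that in the small one. [this work] -/
theorem cluster_swap (ω' : Set (Sym2 V)) (hT : edge (skip v a) (a - 1) ∈ ω' ↔ edge v a ∈ ω') :
    openEdgeCluster (swap v a ω' ∩ edgeSet (n + 1) v) (v 0) = expand v a (openEdgeCluster (ω' ∩ edgeSet n (skip v a)) (v 0)) := by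
  have hs0 : skip v a 0 = v 0 := skip_lt (by omega)
  have hR := openEdgeCluster_eq ω' hn (skip_inj hinj) (skip_per hper ha1 han)
  rw [hs0] at hR
  rw [openEdgeCluster_eq (swap v a ω') (by omega) hinj hper, hR, pre_swap hn hinj hper ha1 han ω' hT, suf_swap hn hinj hper ha1 han ω' hT]
  set p := pre n (skip v a) ω' with hp
  set q := suf n (skip v a) ω' with hq
  have hpn : p ≤ n := pre_le ω'
  have hqn : q ≤ n := suf_le ω'
  -- membership of the merged pair in the small cluster
  have hmid : ∀ P : ℕ → Prop, (edge (skip v a) (a - 1) ∈ {e : Sym2 V | ∃ j, j < n ∧ e = edge (skip v a) j ∧ P j}) ↔ P (a - 1) := by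
    intro P
    constructor
    · rintro ⟨j, hj, he, hP⟩
      have hj' : j = a - 1 := (edge_inj hn (skip_inj hinj) (skip_per hper ha1 han) (by omega) hj he).symm
      rw [hj'] at hP; exact hP
    · exact fun h => ⟨a - 1, by omega, rfl, h⟩
  ext e
  simp only [expand, Set.mem_setOf_eq]
  constructor
  · rintro ⟨i, hi, rfl, hrun⟩
    by_cases hi1 : i + 1 < a
    · left
      refine ⟨⟨i, by omega, (edge_skip_lt hi1).symm, ?_⟩, fun h => mid_ne_edge hn hinj hper ha1 han hi h.symm⟩
      split_ifs at hrun with h1 h2 <;> omega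
    · by_cases hia : i = a - 1 ∨ i = a
      · right
        refine ⟨⟨a - 1, by omega, rfl, ?_⟩, hia.imp (fun h => by rw [h]) (fun h => by rw [h])⟩
        split_ifs at hrun with h1 h2 <;> omega
      · left
        refine ⟨⟨i - 1, by omega, by rw [edge_skip_ge (by omega), show i - 1 + 1 = i by omega], ?_⟩,
          fun h => mid_ne_edge hn hinj hper ha1 han hi h.symm⟩
        split_ifs at hrun with h1 h2 <;> omega
  · rintro (⟨⟨j, hj, rfl, hrun⟩, hne⟩ | ⟨hmem, he⟩)
    · by_cases hja : j + 1 < a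
      · refine ⟨j, by omega, (edge_skip_lt hja).symm ▸ rfl, ?_⟩
        split_ifs with h1 h2 <;> omega
      · have hja' : a ≤ j := by
          by_contra h
          exact hne (by rw [show j = a - 1 by omega])
        refine ⟨j + 1, by omega, (edge_skip_ge hja').symm ▸ rfl, ?_⟩
        split_ifs with h1 h2 <;> omega
    · have hP := (hmid _).1 hmem
      rcases he with rfl | rfl
      · exact ⟨a - 1, by omega, rfl, by split_ifs with h1 h2 <;> omega⟩
      · exact ⟨a, by omega, rfl, by split_ifs with h1 h2 <;> omega⟩

end Word

end Cyc

end Antithetic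

end Summit.CriticalPhenomena.PercolationContinuityZ3.Theorems
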